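import Summits.Ventures.Crystal3D.Theorems.StickyWulffConstantGenericWallFloorDozenStep
import Summits.Ventures.Crystal3D.Theorems.StickyWulffConstantGenericWallFloorTwinFrame
import HarnessLib

/-!
# Terrace propagation: the twin dozen spreads in-plane through clean balls, and no full shell sits next to it

HONEST FRAMING. Part of the venture `Summits/Ventures/Crystal3D` (cell `crystal3d-full`), helper for the
crux `CoaxialWallLaw` (stmt-Ventures-19481) of `route-Ventures-StickyWulffConstant`, REGISTERED line
`WallLedgerF` (planner cf-p1 gen 16), open stub `stub_coaxialTwoSlabAdhesion` (general fillings).  Brick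
towards F-N3 («riser density») of the general-filling architecture for the CO-AXIAL cell: the COHERENT
TERRACES of the wall — maximal in-plane-connected sets of twin-dozen balls on one basal plane — are RIGID:
they propagate through every clean ball and no full-shell ball of the same frame is ever an in-plane
neighbour of a terrace ball.  So a terrace ends only at a payer, and two neighbouring slot lines of the
grain capped by coherent twin dozens are capped ON THE SAME PLANE (next file).  Pure local geometry of
the slot dozen; rung credit only; F-C1 not moved.

SETTING.  `A` a grain frame, `n` a unit `{111}` normal of the grain in MENU position
(`⟪A w, n⟫ ∈ {0, ±√(2/3)}` for the twelve slots `w`).  A ball `y ∈ X` is a TWIN DOZEN for `(A, n)` when its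
nine slots `y + A w` with `⟪A w, n⟫ ≤ 0` are occupied, the three mirror sites `y + A w − 2⟪A w, n⟫ n`
(`⟪A w, n⟫ < 0`) are occupied and the three FAR slots (`⟪A w, n⟫ > 0`) are EMPTY — the second alternative
of `fullShell_or_twinDozen_of_allButOne` / `line_step` (…DozenStep) and the shape of an exact twin cap.

* `eq_zero_of_inner_eq_zero_of_indep` — a vector orthogonal to three independent vectors of `ℝ³` vanishes.
* `exists_far_frame` — the three far slots `u₁, u₂, u₃`: `⟪A uᵢ, n⟫ = √(2/3)`, pairwise `⟪uᵢ, uⱼ⟫ = ½`,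
  linearly independent, and every far slot is one of them (`card_far_slots_eq_three`).
* `inPlane_slot_eq_sub_far` — every IN-PLANE slot `w` (`⟪A w, n⟫ = 0`) is a difference `uᵢ − uⱼ` of two far
  slots (`A(u₁ + u₂ + u₃) = √6 n`, so the three `⟪w, uᵢ⟫ ∈ {0, ±½}` sum to zero and are not all zero).
* `add_far_notMem_of_twinDozen` — **no full shell beside a terrace ball**: if `y` is a twin dozen and
  `uᵢ ≠ uⱼ` are far slots then the in-plane neighbour `y′ = y + A(uᵢ − uⱼ)` has the EMPTY far slot
  `y′ + A uⱼ = y + A uᵢ`; in particular `y′` does not carry a full `A`-shell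
  (`not_fullShell_of_twinDozen_inPlane`).
* `twinDozen_inPlane_propagate` — **terrace propagation**: if moreover `y′ ∈ X` is saturated and all its
  contact neighbours but at most one are saturated (inputs `KissingGap δ`, `KissingClassification δ` BY
  NAME, through `fullShell_or_twinDozen_of_allButOne`), then `y′` is a twin dozen for the SAME `(A, n)`.
  Mechanism: `y′` has the three independent exact slot neighbours `y′ + A(uⱼ − uᵢ) = y`,
  `y′ + A(uₖ − uᵢ)`, `y′ − A uᵢ` (pairwise adjacent slots); the full-shell alternative is excluded by the
  empty far slot; in the twin alternative with normal `n′` the occupied/empty pattern around `y′` forces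
  `⟪A uₗ, n′⟫ = √(2/3) = ⟪A uₗ, n⟫` for `l = 1, 2, 3`, hence `n′ = n`.

WHAT THIS IS NOT: no counting (terrace perimeters, riser density) — next files; not the stub; F-C1 not
moved.
-/

noncomputable section

namespace Summit.Ventures.Crystal3D.Theorems

open Summit.Ventures.Crystal3D Finset
open Literature.MathematicalPhysics.StatisticalMechanics (fccStacking)
open scoped InnerProductSpace

variable {X : Finset (EuclideanSpace ℝ (Fin 3))}

/-! ### Linear algebra -/

/-- A vector of `ℝ³` orthogonal to three linearly independent vectors is zero. -/
theorem eq_zero_of_inner_eq_zero_of_indep {a b c ν : EuclideanSpace ℝ (Fin 3)}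
    (h : LinearIndependent ℝ ![a, b, c]) (ha : ⟪a, ν⟫_ℝ = 0) (hb : ⟪b, ν⟫_ℝ = 0) (hc : ⟪c, ν⟫_ℝ = 0) :
    ν = 0 := by
  have hspan := h.span_eq_top_of_card_eq_finrank' (by simp)
  have hν : ν ∈ Submodule.span ℝ (Set.range ![a, b, c]) := by
    rw [hspan]; exact Submodule.mem_top
  obtain ⟨co, hco⟩ := (Submodule.mem_span_range_iff_exists_fun ℝ).1 hν
  simp only [Fin.sum_univ_three, Matrix.cons_val_zero, Matrix.cons_val_one, Matrix.cons_val] at hco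
  have : ⟪ν, ν⟫_ℝ = 0 := by
    calc ⟪ν, ν⟫_ℝ = ⟪co 0 • a + co 1 • b + co 2 • c, ν⟫_ℝ := by rw [hco]
      _ = 0 := by simp only [inner_add_left, real_inner_smul_left, ha, hb, hc, mul_zero, add_zero]
  exact inner_self_eq_zero.1 this

/-! ### The far frame of a `{111}` normal -/

/-- **The far frame.**  For a unit normal `n` in menu position the three far slots `u₁, u₂, u₃`
(`⟪A uᵢ, n⟫ = √(2/3)`) are pairwise adjacent (`⟪uᵢ, uⱼ⟫ = ½`), linearly independent, and exhaust the far
slots. -/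
theorem exists_far_frame (A : EuclideanSpace ℝ (Fin 3) ≃ₗᵢ[ℝ] EuclideanSpace ℝ (Fin 3))
    {n : EuclideanSpace ℝ (Fin 3)} (hn : ‖n‖ = 1)
    (hmenu : ∀ w ∈ fccSlots, ⟪A w, n⟫_ℝ = 0 ∨ ⟪A w, n⟫_ℝ = Real.sqrt (2 / 3) ∨ ⟪A w, n⟫_ℝ = -Real.sqrt (2 / 3)) :
    ∃ u₁ ∈ fccSlots, ∃ u₂ ∈ fccSlots, ∃ u₃ ∈ fccSlots,
      ⟪A u₁, n⟫_ℝ = Real.sqrt (2 / 3) ∧ ⟪A u₂, n⟫_ℝ = Real.sqrt (2 / 3) ∧ ⟪A u₃, n⟫_ℝ = Real.sqrt (2 / 3) ∧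
      ⟪u₁, u₂⟫_ℝ = 1 / 2 ∧ ⟪u₁, u₃⟫_ℝ = 1 / 2 ∧ ⟪u₂, u₃⟫_ℝ = 1 / 2 ∧
      LinearIndependent ℝ ![u₁, u₂, u₃] ∧
      ∀ w ∈ fccSlots, 0 < ⟪A w, n⟫_ℝ → w = u₁ ∨ w = u₂ ∨ w = u₃ := by
  classical
  have hrpos : 0 < Real.sqrt (2 / 3) := Real.sqrt_pos.2 (by norm_num)
  obtain ⟨u₁, hu₁, u₂, hu₂, u₃, hu₃, h12, h13, h23, hn₁, hn₂, hn₃⟩ := exists_three_far_slots A hn hmenu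
  have p₁ : 0 < ⟪A u₁, n⟫_ℝ := by rw [hn₁]; exact hrpos
  have p₂ : 0 < ⟪A u₂, n⟫_ℝ := by rw [hn₂]; exact hrpos
  have p₃ : 0 < ⟪A u₃, n⟫_ℝ := by rw [hn₃]; exact hrpos
  have i12 := inner_eq_half_of_pos_pos A hn hmenu hu₁ hu₂ h12 p₁ p₂
  have i13 := inner_eq_half_of_pos_pos A hn hmenu hu₁ hu₃ h13 p₁ p₃
  have i23 := inner_eq_half_of_pos_pos A hn hmenu hu₂ hu₃ h23 p₂ p₃
  refine ⟨u₁, hu₁, u₂, hu₂, u₃, hu₃, hn₁, hn₂, hn₃, i12, i13, i23,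
    linearIndependent_of_pairwise_half hu₁ hu₂ hu₃ i12 i13 i23, ?_⟩
  -- the far slots are exactly three
  intro w hw hpos
  by_contra hne
  push Not at hne
  obtain ⟨hne1, hne2, hne3⟩ := hne
  have hsub : ({u₁, u₂, u₃, w} : Finset (EuclideanSpace ℝ (Fin 3))) ⊆
      fccSlots.filter fun w => 0 < ⟪A w, n⟫_ℝ := by
    intro v hv
    simp only [mem_insert, mem_singleton] at hv
    rw [mem_filter]
    rcases hv with rfl | rfl | rfl | rfl
    · exact ⟨hu₁, p₁⟩
    · exact ⟨hu₂, p₂⟩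
    · exact ⟨hu₃, p₃⟩
    · exact ⟨hw, hpos⟩
  have hcard4 : ({u₁, u₂, u₃, w} : Finset (EuclideanSpace ℝ (Fin 3))).card = 4 := by
    rw [card_insert_of_notMem, card_insert_of_notMem, card_insert_of_notMem, card_singleton]
    · simp only [mem_singleton]; exact fun h => hne3 h.symm
    · simp only [mem_insert, mem_singleton, not_or]; exact ⟨h23, fun h => hne2 h.symm⟩
    · simp only [mem_insert, mem_singleton, not_or]; exact ⟨h12, h13, fun h => hne1 h.symm⟩
  have := card_le_card hsub
  rw [hcard4, card_far_slots_eq_three A hn hmenu] at this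
  omega

/-- **In-plane slots are differences of far slots.**  With `u₁, u₂, u₃` the far frame of `(A, n)`, every
slot `w` with `⟪A w, n⟫ = 0` is `uᵢ − uⱼ` for an ordered pair `i ≠ j`. -/
theorem inPlane_slot_eq_sub_far (A : EuclideanSpace ℝ (Fin 3) ≃ₗᵢ[ℝ] EuclideanSpace ℝ (Fin 3))
    {n : EuclideanSpace ℝ (Fin 3)} (hn : ‖n‖ = 1) {u₁ u₂ u₃ : EuclideanSpace ℝ (Fin 3)}
    (hu₁ : u₁ ∈ fccSlots) (hu₂ : u₂ ∈ fccSlots) (hu₃ : u₃ ∈ fccSlots)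
    (hn₁ : ⟪A u₁, n⟫_ℝ = Real.sqrt (2 / 3)) (hn₂ : ⟪A u₂, n⟫_ℝ = Real.sqrt (2 / 3))
    (hn₃ : ⟪A u₃, n⟫_ℝ = Real.sqrt (2 / 3))
    (i12 : ⟪u₁, u₂⟫_ℝ = 1 / 2) (i13 : ⟪u₁, u₃⟫_ℝ = 1 / 2) (i23 : ⟪u₂, u₃⟫_ℝ = 1 / 2)
    (hind : LinearIndependent ℝ ![u₁, u₂, u₃])
    {w : EuclideanSpace ℝ (Fin 3)} (hw : w ∈ fccSlots) (hw0 : ⟪A w, n⟫_ℝ = 0) :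
    w = u₁ - u₂ ∨ w = u₂ - u₁ ∨ w = u₁ - u₃ ∨ w = u₃ - u₁ ∨ w = u₂ - u₃ ∨ w = u₃ - u₂ := by
  have hrpos : 0 < Real.sqrt (2 / 3) := Real.sqrt_pos.2 (by norm_num)
  have hw1 := norm_eq_one_of_mem_fccSlots hw
  have h1 := norm_eq_one_of_mem_fccSlots hu₁
  have h2 := norm_eq_one_of_mem_fccSlots hu₂
  have h3 := norm_eq_one_of_mem_fccSlots hu₃
  -- `A (u₁ + u₂ + u₃) = √6 n`, so the three inner products of `w` with the `uᵢ` sum to `0`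
  have hsum6 := sum_eq_sqrt_six_smul (A u₁) (A u₂) (A u₃) n
    (by rw [LinearIsometryEquiv.norm_map, h1]) (by rw [LinearIsometryEquiv.norm_map, h2])
    (by rw [LinearIsometryEquiv.norm_map, h3]) hn
    (by rw [LinearIsometryEquiv.inner_map_map, i12]) (by rw [LinearIsometryEquiv.inner_map_map, i13])
    (by rw [LinearIsometryEquiv.inner_map_map, i23]) hn₁ hn₂ hn₃
  have hsum : ⟪w, u₁⟫_ℝ + ⟪w, u₂⟫_ℝ + ⟪w, u₃⟫_ℝ = 0 := by
    have e : ⟪A w, A u₁ + A u₂ + A u₃⟫_ℝ = ⟪w, u₁⟫_ℝ + ⟪w, u₂⟫_ℝ + ⟪w, u₃⟫_ℝ := by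
      rw [inner_add_right, inner_add_right, LinearIsometryEquiv.inner_map_map,
        LinearIsometryEquiv.inner_map_map, LinearIsometryEquiv.inner_map_map]
    rw [← e, hsum6, real_inner_smul_right, hw0, mul_zero]
  -- each `⟪w, uᵢ⟫` is in `{½, 0, −½}`: the values `±1` would make `w = ±uᵢ` non-in-plane
  have val : ∀ {u : EuclideanSpace ℝ (Fin 3)}, u ∈ fccSlots → ⟪A u, n⟫_ℝ = Real.sqrt (2 / 3) →
      ⟪w, u⟫_ℝ = 1 / 2 ∨ ⟪w, u⟫_ℝ = 0 ∨ ⟪w, u⟫_ℝ = -(1 / 2) := by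
    intro u hu hun
    have hu1 := norm_eq_one_of_mem_fccSlots hu
    rcases inner_slots_mem hw hu with h | h | h | h | h
    · exfalso
      have e0 : ‖w - u‖ ^ 2 = 0 := by rw [norm_sub_sq_real, hw1, hu1, h]; norm_num
      have : w = u := sub_eq_zero.1 (norm_eq_zero.1 (pow_eq_zero_iff two_ne_zero |>.1 e0))
      rw [this, hun] at hw0
      exact hrpos.ne' hw0
    · exact Or.inl h
    · exact Or.inr (Or.inl h)
    · exact Or.inr (Or.inr h)
    · exfalso
      have e0 : ‖w + u‖ ^ 2 = 0 := by rw [norm_add_sq_real, hw1, hu1, h]; norm_num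
      have : w = -u := eq_neg_of_add_eq_zero_left (norm_eq_zero.1 (pow_eq_zero_iff two_ne_zero |>.1 e0))
      rw [this, map_neg, inner_neg_left, hun] at hw0
      exact hrpos.ne' (neg_eq_zero.1 hw0)
  -- the difference formula: `⟪w, uᵢ⟫ = ½`, `⟪w, uⱼ⟫ = −½` force `w = uᵢ − uⱼ`
  have diff : ∀ {u v : EuclideanSpace ℝ (Fin 3)}, u ∈ fccSlots → v ∈ fccSlots → ⟪u, v⟫_ℝ = 1 / 2 →
      ⟪w, u⟫_ℝ = 1 / 2 → ⟪w, v⟫_ℝ = -(1 / 2) → w = u - v := by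
    intro u v hu hv huv hwu hwv
    have hu1 := norm_eq_one_of_mem_fccSlots hu
    have hv1 := norm_eq_one_of_mem_fccSlots hv
    have e0 : ‖w - (u - v)‖ ^ 2 = 0 := by
      rw [norm_sub_sq_real, norm_sub_sq_real, hw1, hu1, hv1, huv, inner_sub_right, hwu, hwv]; norm_num
    exact sub_eq_zero.1 (norm_eq_zero.1 (pow_eq_zero_iff two_ne_zero |>.1 e0))
  have i21 : ⟪u₂, u₁⟫_ℝ = 1 / 2 := by rw [real_inner_comm]; exact i12
  have i31 : ⟪u₃, u₁⟫_ℝ = 1 / 2 := by rw [real_inner_comm]; exact i13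
  have i32 : ⟪u₃, u₂⟫_ℝ = 1 / 2 := by rw [real_inner_comm]; exact i23
  -- not all three inner products vanish
  have hnz : ¬ (⟪w, u₁⟫_ℝ = 0 ∧ ⟪w, u₂⟫_ℝ = 0 ∧ ⟪w, u₃⟫_ℝ = 0) := by
    rintro ⟨a, b, c⟩
    have := eq_zero_of_inner_eq_zero_of_indep hind (by rw [real_inner_comm]; exact a)
      (by rw [real_inner_comm]; exact b) (by rw [real_inner_comm]; exact c)
    rw [this, norm_zero] at hw1
    exact zero_ne_one hw1
  -- which index carries `+½` and which `−½`
  have key : (⟪w, u₁⟫_ℝ = 1 / 2 ∧ ⟪w, u₂⟫_ℝ = -(1 / 2)) ∨ (⟪w, u₂⟫_ℝ = 1 / 2 ∧ ⟪w, u₁⟫_ℝ = -(1 / 2)) ∨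
      (⟪w, u₁⟫_ℝ = 1 / 2 ∧ ⟪w, u₃⟫_ℝ = -(1 / 2)) ∨ (⟪w, u₃⟫_ℝ = 1 / 2 ∧ ⟪w, u₁⟫_ℝ = -(1 / 2)) ∨
      (⟪w, u₂⟫_ℝ = 1 / 2 ∧ ⟪w, u₃⟫_ℝ = -(1 / 2)) ∨ (⟪w, u₃⟫_ℝ = 1 / 2 ∧ ⟪w, u₂⟫_ℝ = -(1 / 2)) := by
    rcases val hu₁ hn₁ with a | a | a <;> rcases val hu₂ hn₂ with b | b | b <;>
      rcases val hu₃ hn₃ with c | c | c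
    all_goals first
      | (exfalso; linarith)
      | (exfalso; exact hnz ⟨‹⟪w, u₁⟫_ℝ = 0›, ‹⟪w, u₂⟫_ℝ = 0›, ‹⟪w, u₃⟫_ℝ = 0›⟩)
      | exact Or.inl ⟨‹⟪w, u₁⟫_ℝ = 1 / 2›, ‹⟪w, u₂⟫_ℝ = -(1 / 2)›⟩
      | exact Or.inr (Or.inl ⟨‹⟪w, u₂⟫_ℝ = 1 / 2›, ‹⟪w, u₁⟫_ℝ = -(1 / 2)›⟩)
      | exact Or.inr (Or.inr (Or.inl ⟨‹⟪w, u₁⟫_ℝ = 1 / 2›, ‹⟪w, u₃⟫_ℝ = -(1 / 2)›⟩))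
      | exact Or.inr (Or.inr (Or.inr (Or.inl ⟨‹⟪w, u₃⟫_ℝ = 1 / 2›, ‹⟪w, u₁⟫_ℝ = -(1 / 2)›⟩)))
      | exact Or.inr (Or.inr (Or.inr (Or.inr (Or.inl ⟨‹⟪w, u₂⟫_ℝ = 1 / 2›, ‹⟪w, u₃⟫_ℝ = -(1 / 2)›⟩))))
      | exact Or.inr (Or.inr (Or.inr (Or.inr (Or.inr ⟨‹⟪w, u₃⟫_ℝ = 1 / 2›, ‹⟪w, u₂⟫_ℝ = -(1 / 2)›⟩))))
  rcases key with ⟨a, b⟩ | ⟨a, b⟩ | ⟨a, b⟩ | ⟨a, b⟩ | ⟨a, b⟩ | ⟨a, b⟩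
  · exact Or.inl (diff hu₁ hu₂ i12 a b)
  · exact Or.inr (Or.inl (diff hu₂ hu₁ i21 a b))
  · exact Or.inr (Or.inr (Or.inl (diff hu₁ hu₃ i13 a b)))
  · exact Or.inr (Or.inr (Or.inr (Or.inl (diff hu₃ hu₁ i31 a b))))
  · exact Or.inr (Or.inr (Or.inr (Or.inr (Or.inl (diff hu₂ hu₃ i23 a b)))))
  · exact Or.inr (Or.inr (Or.inr (Or.inr (Or.inr (diff hu₃ hu₂ i32 a b)))))

/-! ### No full shell beside a terrace ball -/

/-- **The empty far slot of an in-plane neighbour.**  If the far slots of `y` (frame `A`, normal `n`) are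
empty and `uᵢ, uⱼ` are far slots, then the in-plane neighbour position `y′ = y + A(uᵢ − uⱼ)` has the
empty slot `y′ + A uⱼ = y + A uᵢ`. -/
theorem add_far_notMem_of_twinDozen (A : EuclideanSpace ℝ (Fin 3) ≃ₗᵢ[ℝ] EuclideanSpace ℝ (Fin 3))
    {n y uᵢ uⱼ : EuclideanSpace ℝ (Fin 3)}
    (hfar : ∀ w ∈ fccSlots, 0 < ⟪A w, n⟫_ℝ → y + A w ∉ X)
    (hi : uᵢ ∈ fccSlots) (hipos : 0 < ⟪A uᵢ, n⟫_ℝ) :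
    y + A (uᵢ - uⱼ) + A uⱼ ∉ X := by
  rw [add_assoc, ← map_add, sub_add_cancel]
  exact hfar uᵢ hi hipos

/-- **No full shell beside a terrace ball.**  Under the same hypotheses the in-plane neighbour
`y′ = y + A(uᵢ − uⱼ)` does not carry a full `A`-shell. -/
theorem not_fullShell_of_twinDozen_inPlane (A : EuclideanSpace ℝ (Fin 3) ≃ₗᵢ[ℝ] EuclideanSpace ℝ (Fin 3))
    {n y uᵢ uⱼ : EuclideanSpace ℝ (Fin 3)}
    (hfar : ∀ w ∈ fccSlots, 0 < ⟪A w, n⟫_ℝ → y + A w ∉ X)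
    (hi : uᵢ ∈ fccSlots) (hipos : 0 < ⟪A uᵢ, n⟫_ℝ) (hj : uⱼ ∈ fccSlots) :
    ¬ ∀ w ∈ fccSlots, y + A (uᵢ - uⱼ) + A w ∈ X :=
  fun h => add_far_notMem_of_twinDozen A hfar hi hipos (h uⱼ hj)

/-! ### Terrace propagation -/

/-- **Terrace propagation.**  Let `y ∈ X` be a twin dozen for `(A, n)` (menu normal; own side occupied;
mirror sites occupied; far slots empty) and let `uᵢ ≠ uⱼ` be far slots.  If the in-plane neighbour
`y′ = y + A(uᵢ − uⱼ)` is saturated and all its contact neighbours except possibly `y₀` are saturated, then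
`y′` is a twin dozen for the SAME `(A, n)`.  Inputs `KissingGap δ`, `KissingClassification δ` by name. -/
theorem twinDozen_inPlane_propagate {δ : ℝ} (hg : KissingGap δ) (hc : KissingClassification δ)
    (hX : ∀ p ∈ X, ∀ q ∈ X, p ≠ q → 1 ≤ dist p q)
    (A : EuclideanSpace ℝ (Fin 3) ≃ₗᵢ[ℝ] EuclideanSpace ℝ (Fin 3)) {n : EuclideanSpace ℝ (Fin 3)}
    (hn : ‖n‖ = 1)
    (hmenu : ∀ w ∈ fccSlots, ⟪A w, n⟫_ℝ = 0 ∨ ⟪A w, n⟫_ℝ = Real.sqrt (2 / 3) ∨ ⟪A w, n⟫_ℝ = -Real.sqrt (2 / 3))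
    {y : EuclideanSpace ℝ (Fin 3)} (hy : y ∈ X)
    (hown : ∀ w ∈ fccSlots, ⟪A w, n⟫_ℝ ≤ 0 → y + A w ∈ X)
    (hfar : ∀ w ∈ fccSlots, 0 < ⟪A w, n⟫_ℝ → y + A w ∉ X)
    {uᵢ uⱼ : EuclideanSpace ℝ (Fin 3)} (hi : uᵢ ∈ fccSlots) (hj : uⱼ ∈ fccSlots) (hij : uᵢ ≠ uⱼ)
    (hipos : 0 < ⟪A uᵢ, n⟫_ℝ) (hjpos : 0 < ⟪A uⱼ, n⟫_ℝ)
    (h12 : (X.filter fun q => dist (y + A (uᵢ - uⱼ)) q = 1).card = 12) (y₀ : EuclideanSpace ℝ (Fin 3))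
    (hnb : ∀ z ∈ X, dist (y + A (uᵢ - uⱼ)) z = 1 → z ≠ y₀ → (X.filter fun q => dist z q = 1).card = 12) :
    (∀ w ∈ fccSlots, ⟪A w, n⟫_ℝ ≤ 0 → y + A (uᵢ - uⱼ) + A w ∈ X) ∧
    (∀ w ∈ fccSlots, ⟪A w, n⟫_ℝ < 0 → y + A (uᵢ - uⱼ) + (A w - (2 * ⟪A w, n⟫_ℝ) • n) ∈ X) ∧
    (∀ w ∈ fccSlots, 0 < ⟪A w, n⟫_ℝ → y + A (uᵢ - uⱼ) + A w ∉ X) := by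
  have hrpos : 0 < Real.sqrt (2 / 3) := Real.sqrt_pos.2 (by norm_num)
  -- the far frame, with `uᵢ`, `uⱼ` two of its members and `uₖ` the third
  obtain ⟨u₁, hu₁, u₂, hu₂, u₃, hu₃, hn₁, hn₂, hn₃, i12, i13, i23, hind, hall⟩ := exists_far_frame A hn hmenu
  have menu_pos : ∀ {u : EuclideanSpace ℝ (Fin 3)}, u ∈ fccSlots → 0 < ⟪A u, n⟫_ℝ →
      ⟪A u, n⟫_ℝ = Real.sqrt (2 / 3) := by
    intro u hu hpos
    rcases hmenu u hu with h | h | h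
    · rw [h] at hpos; exact absurd hpos (lt_irrefl 0)
    · exact h
    · rw [h] at hpos; linarith
  have hni : ⟪A uᵢ, n⟫_ℝ = Real.sqrt (2 / 3) := menu_pos hi hipos
  have hnj : ⟪A uⱼ, n⟫_ℝ = Real.sqrt (2 / 3) := menu_pos hj hjpos
  have iij : ⟪uᵢ, uⱼ⟫_ℝ = 1 / 2 := inner_eq_half_of_pos_pos A hn hmenu hi hj hij hipos hjpos
  -- a third far slot `uₖ ∉ {uᵢ, uⱼ}`
  obtain ⟨uₖ, hk, hkpos, hki, hkj⟩ : ∃ uₖ ∈ fccSlots, 0 < ⟪A uₖ, n⟫_ℝ ∧ uₖ ≠ uᵢ ∧ uₖ ≠ uⱼ := by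
    have p₁ : 0 < ⟪A u₁, n⟫_ℝ := by rw [hn₁]; exact hrpos
    have p₂ : 0 < ⟪A u₂, n⟫_ℝ := by rw [hn₂]; exact hrpos
    have p₃ : 0 < ⟪A u₃, n⟫_ℝ := by rw [hn₃]; exact hrpos
    have d12 : u₁ ≠ u₂ := by
      intro h; rw [h, real_inner_self_eq_norm_sq, norm_eq_one_of_mem_fccSlots hu₂] at i12; norm_num at i12
    have d13 : u₁ ≠ u₃ := by
      intro h; rw [h, real_inner_self_eq_norm_sq, norm_eq_one_of_mem_fccSlots hu₃] at i13; norm_num at i13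
    have d23 : u₂ ≠ u₃ := by
      intro h; rw [h, real_inner_self_eq_norm_sq, norm_eq_one_of_mem_fccSlots hu₃] at i23; norm_num at i23
    rcases hall uᵢ hi hipos with rfl | rfl | rfl <;> rcases hall uⱼ hj hjpos with rfl | rfl | rfl
    all_goals first
      | exact absurd rfl hij
      | exact ⟨u₃, hu₃, p₃, d13.symm, d23.symm⟩
      | exact ⟨u₂, hu₂, p₂, d12.symm, d23⟩
      | exact ⟨u₁, hu₁, p₁, d12, d13⟩
      | exact ⟨u₃, hu₃, p₃, d23.symm, d13.symm⟩
      | exact ⟨u₁, hu₁, p₁, d13, d12⟩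
      | exact ⟨u₂, hu₂, p₂, d23, d12.symm⟩
  have hnk : ⟪A uₖ, n⟫_ℝ = Real.sqrt (2 / 3) := menu_pos hk hkpos
  have iki : ⟪uₖ, uᵢ⟫_ℝ = 1 / 2 := inner_eq_half_of_pos_pos A hn hmenu hk hi hki hkpos hipos
  have ikj : ⟪uₖ, uⱼ⟫_ℝ = 1 / 2 := inner_eq_half_of_pos_pos A hn hmenu hk hj hkj hkpos hjpos
  have iji : ⟪uⱼ, uᵢ⟫_ℝ = 1 / 2 := by rw [real_inner_comm]; exact iij
  -- the three exact slot neighbours of `y′`: `uⱼ − uᵢ ↦ y`, `uₖ − uᵢ ↦ y + A(uₖ − uⱼ)`, `−uᵢ ↦ y − A uⱼ`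
  have hsa : uⱼ - uᵢ ∈ fccSlots := sub_mem_fccSlots_of_inner_eq_half hj hi iji
  have hsb : uₖ - uᵢ ∈ fccSlots := sub_mem_fccSlots_of_inner_eq_half hk hi iki
  have hsc : -uᵢ ∈ fccSlots := neg_mem_fccSlots hi
  have hskj : uₖ - uⱼ ∈ fccSlots := sub_mem_fccSlots_of_inner_eq_half hk hj ikj
  have hi1 : ⟪uᵢ, uᵢ⟫_ℝ = 1 := by rw [real_inner_self_eq_norm_sq, norm_eq_one_of_mem_fccSlots hi, one_pow]
  have iab : ⟪uⱼ - uᵢ, uₖ - uᵢ⟫_ℝ = 1 / 2 := by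
    rw [inner_sub_left, inner_sub_right, inner_sub_right, real_inner_comm uₖ uⱼ, ikj, iji,
      real_inner_comm uₖ uᵢ, iki, hi1]; norm_num
  have iac : ⟪uⱼ - uᵢ, -uᵢ⟫_ℝ = 1 / 2 := by
    rw [inner_neg_right, inner_sub_left, iji, hi1]; norm_num
  have ibc : ⟪uₖ - uᵢ, -uᵢ⟫_ℝ = 1 / 2 := by
    rw [inner_neg_right, inner_sub_left, iki, hi1]; norm_num
  have hind' : LinearIndependent ℝ ![uⱼ - uᵢ, uₖ - uᵢ, -uᵢ] :=
    linearIndependent_of_pairwise_half hsa hsb hsc iab iac ibc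
  have haX : y + A (uᵢ - uⱼ) + A (uⱼ - uᵢ) ∈ X := by
    rw [add_assoc, ← map_add, show uᵢ - uⱼ + (uⱼ - uᵢ) = 0 by abel, map_zero, add_zero]; exact hy
  have hbX : y + A (uᵢ - uⱼ) + A (uₖ - uᵢ) ∈ X := by
    rw [add_assoc, ← map_add, show uᵢ - uⱼ + (uₖ - uᵢ) = uₖ - uⱼ by abel]
    apply hown _ hskj
    rw [map_sub, inner_sub_left, hnk, hnj, sub_self]
  have hcX : y + A (uᵢ - uⱼ) + A (-uᵢ) ∈ X := by
    rw [add_assoc, ← map_add, show uᵢ - uⱼ + -uᵢ = -uⱼ by abel]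
    apply hown _ (neg_mem_fccSlots hj)
    rw [map_neg, inner_neg_left, hnj]; linarith
  -- the dozen step at `y′`
  rcases fullShell_or_twinDozen_of_allButOne hg hc hX h12 y₀ hnb A hsa hsb hsc hind' haX hbX hcX with
    hfull | ⟨n', hn', hmenu', hown', hmirror', hfar', -, -, -⟩
  · exact absurd (hfull uⱼ hj) (add_far_notMem_of_twinDozen A hfar hi hipos)
  · -- the normal `n'` agrees with `n` on the far frame
    have menu_le : ∀ {u : EuclideanSpace ℝ (Fin 3)}, u ∈ fccSlots → ⟪A u, n'⟫_ℝ ≤ Real.sqrt (2 / 3) := by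
      intro u hu
      rcases hmenu' u hu with h | h | h <;> rw [h] <;> linarith
    -- `y′ + A uⱼ = y + A uᵢ` is empty, so `uⱼ` is far for `n'`
    have aj : ⟪A uⱼ, n'⟫_ℝ = Real.sqrt (2 / 3) := by
      have hne : y + A (uᵢ - uⱼ) + A uⱼ ∉ X := add_far_notMem_of_twinDozen A hfar hi hipos
      have hpos : 0 < ⟪A uⱼ, n'⟫_ℝ := by
        by_contra hle; push Not at hle
        exact hne (hown' uⱼ hj hle)
      rcases hmenu' uⱼ hj with h | h | h
      · rw [h] at hpos; exact absurd hpos (lt_irrefl 0)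
      · exact h
      · rw [h] at hpos; linarith
    -- `y′ + A(uⱼ − uᵢ) = y` is occupied, so `⟪A(uⱼ − uᵢ), n'⟫ ≤ 0`, i.e. `uᵢ` is far for `n'`
    have ai : ⟪A uᵢ, n'⟫_ℝ = Real.sqrt (2 / 3) := by
      have hle : ⟪A (uⱼ - uᵢ), n'⟫_ℝ ≤ 0 := by
        by_contra hpos; push Not at hpos
        exact hfar' _ hsa hpos haX
      rw [map_sub, inner_sub_left, aj] at hle
      exact le_antisymm (menu_le hi) (by linarith)
    -- `y′ + A(uⱼ − uₖ) = y + A(uᵢ − uₖ)` is occupied (in-plane own side of `y`), so `uₖ` is far for `n'`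
    have ak : ⟪A uₖ, n'⟫_ℝ = Real.sqrt (2 / 3) := by
      have hsjk : uⱼ - uₖ ∈ fccSlots := sub_mem_fccSlots_of_inner_eq_half hj hk (by rw [real_inner_comm]; exact ikj)
      have hsik : uᵢ - uₖ ∈ fccSlots := sub_mem_fccSlots_of_inner_eq_half hi hk (by rw [real_inner_comm]; exact iki)
      have hocc : y + A (uᵢ - uⱼ) + A (uⱼ - uₖ) ∈ X := by
        rw [add_assoc, ← map_add, show uᵢ - uⱼ + (uⱼ - uₖ) = uᵢ - uₖ by abel]
        apply hown _ hsik
        rw [map_sub, inner_sub_left, hni, hnk, sub_self]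
      have hle : ⟪A (uⱼ - uₖ), n'⟫_ℝ ≤ 0 := by
        by_contra hpos; push Not at hpos
        exact hfar' _ hsjk hpos hocc
      rw [map_sub, inner_sub_left, aj] at hle
      exact le_antisymm (menu_le hk) (by linarith)
    -- hence `n' = n`
    have hind3 : LinearIndependent ℝ ![A uⱼ, A uₖ, A uᵢ] := by
      have hjk : uⱼ ≠ uₖ := fun h => hkj h.symm
      have ijk : ⟪uⱼ, uₖ⟫_ℝ = 1 / 2 := by rw [real_inner_comm]; exact ikj
      exact linearIndependent_map_triple A (linearIndependent_of_pairwise_half hj hk hi ijk iji iki)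
    have hnn : n' = n := by
      have h0 : n' - n = 0 := eq_zero_of_inner_eq_zero_of_indep hind3
        (by rw [inner_sub_right, aj, hnj, sub_self]) (by rw [inner_sub_right, ak, hnk, sub_self])
        (by rw [inner_sub_right, ai, hni, sub_self])
      exact sub_eq_zero.1 h0
    subst hnn
    exact ⟨hown', hmirror', hfar'⟩

end Summit.Ventures.Crystal3D.Theorems

end
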